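import Summits.CriticalPhenomena.PercolationContinuityZ3.Theorems.PercNearOneGluingNoHeavyLowerTailIncStarTwoSepEvents
import Summits.CriticalPhenomena.PercolationContinuityZ3.Theorems.PercNearOneGluingNoHeavyLowerTailIncStarTwoSepReal
import Summits.CriticalPhenomena.PercolationContinuityZ3.Theorems.PercNearOneGluingNoHeavyLowerTailIncStarBridgeEvents
import Summits.CriticalPhenomena.PercolationContinuityZ3.Theorems.PercNearOneGluingNoHeavyLowerTailIncStarSlackEdgeBase
import HarnessLib

/-!
# The two-separation gluing theorem for the increasing star, III: the seven moments

Support file for the Sahi programme (`--supports stmt-CriticalPhenomena-4575`, prover prim-sahi-p2 gen 23).  No definitions, no named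
facts, no sorries; standard axioms.  Memo `run/shared/lean/prim/prim-sahi/FROM-prim-sahi-p2-gen22-TWO-SEPARATION-GLUING.md` §1 (I1),
`prim-sahi-p2/PROOF-E3.md` §32–§33.

Setting of `…IncStarTwoSepEvents`: root `s`, `x ≠ s`, near side `L` (`s, x ∉ L`), no positive pair between `L` and `V₂ ∖ {x}`
(`V₂ = {y | y ∉ L ∧ y ≠ s}`); targets `a ∈ insert x L`, `b, c ∈ V₂`.  With the near events `A t` (root star into `L`, then `t` inside
`insert x L`), `Λ = A x`, `F a = {x ↔ a in insert x L}` and the far events `B t` (root star into `V₂` — first step `x` allowed —, then `t`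
inside `V₂`), `Ρ = B x`, `F_R t = {x ↔ t in V₂}`, the near numbers `α = P(A a)`, `α_Λ = P(A a ∩ Λ)`, `d_a = P(F a ∖ Λ)`, `λ = P(Λ)` and the
far numbers `β, γ, ρ, d_b = P(F_R b ∖ Ρ), d_c, m_bc = P(B b ∩ B c)`, `σ = P((B⁺b ∩ B⁺c) ∖ (B b ∩ B c))` (`B⁺t = B t ∪ F_R t`), `ρ_b = P(Ρ ∩ B b)`,
`ρ_c`, `ρ_bc`:

* `twoSep_sahiE3_eq` — **(I1)** `E₃({s↔a},{s↔b},{s↔c}) = α·U(λ) + α_Λ·BR2(λ) + d_a·TD(λ)` with the polynomials of `…IncStarTwoSepReal`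
  (the seven moments are near × far polynomials: a.s. `S_a = A a ⊔ ((F a ∖ Λ) ∩ Ρ)`, `S_b = B b ⊔ ((F_R b ∖ Ρ) ∩ Λ)`, independence of the
  blocks `twoSep_indep`, and `(F a ∖ Λ) ∩ Λ = ∅`);
* `rootStar_port_harris` — the near constraint **(L2)** `λ(α + d_a) ≤ α_Λ` (Harris for `A a ∪ F a` and `Λ`);
* `rootStar_pair_harris` — the far constraint `(β + d_b)(γ + d_c) ≤ m_bc + σ` (Harris for `B⁺b`, `B⁺c`).
The real numbers are passed as variables with defining hypotheses (instantiate with `rfl`).  THEOREM G is assembled in `…IncStarTwoSepGlue`.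
-/

noncomputable section

namespace Summit.CriticalPhenomena.PercolationContinuityZ3.Theorems

namespace IncStar

open MeasureTheory Set Literature.Probability.Percolation Literature.Probability.LatticeModels
open scoped Classical

variable {n : ℕ}

/-! ### Harris constraints on one side -/

/-- **(L2)-type constraint**: `P(A x)·(P(A t) + P(F t ∖ A x)) ≤ P(A t ∩ A x)` — Harris for the increasing events `A t ∪ F t` and `A x`,
with `P(A t ∪ F t) = P(A t) + P(F t ∖ A x)` and `(A t ∪ F t) ∩ A x = A t ∩ A x`. [this work] -/
theorem rootStar_port_harris (w : Sym2 (Fin n) → unitInterval) (U V' : Set (Fin n)) (s x t : Fin n) :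
    (prodBernoulli w).real {ω : BondConfig (Fin n) | ∃ u ∈ U, s(s, u) ∈ ω ∧ ω ∈ openConnIn V' u x}
        * ((prodBernoulli w).real {ω : BondConfig (Fin n) | ∃ u ∈ U, s(s, u) ∈ ω ∧ ω ∈ openConnIn V' u t}
          + (prodBernoulli w).real (openConnIn V' x t \ {ω : BondConfig (Fin n) | ∃ u ∈ U, s(s, u) ∈ ω ∧ ω ∈ openConnIn V' u x}))
      ≤ (prodBernoulli w).real ({ω : BondConfig (Fin n) | ∃ u ∈ U, s(s, u) ∈ ω ∧ ω ∈ openConnIn V' u t}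
          ∩ {ω : BondConfig (Fin n) | ∃ u ∈ U, s(s, u) ∈ ω ∧ ω ∈ openConnIn V' u x}) := by
  rw [← rootStar_union_split (prodBernoulli w) U V' s x t, ← rootStar_unionPort_inter_port U V' s x t, mul_comm]
  exact prodBernoulli_harris w ((isUpperSet_rootStar U V' s t).union (isUpperSet_openConnIn V' x t)) (isUpperSet_rootStar U V' s x)
    MeasurableSet.of_discrete MeasurableSet.of_discrete

/-- **Far Harris constraint**: `(P(B b) + P(F b ∖ B x))·(P(B c) + P(F c ∖ B x)) ≤ P(B b ∩ B c) + P((B⁺b ∩ B⁺c) ∖ (B b ∩ B c))`, `B⁺t = B t ∪ F t`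
— Harris for `B⁺b`, `B⁺c`. [this work] -/
theorem rootStar_pair_harris (w : Sym2 (Fin n) → unitInterval) (U V' : Set (Fin n)) (s x b c : Fin n) :
    ((prodBernoulli w).real {ω : BondConfig (Fin n) | ∃ u ∈ U, s(s, u) ∈ ω ∧ ω ∈ openConnIn V' u b}
        + (prodBernoulli w).real (openConnIn V' x b \ {ω : BondConfig (Fin n) | ∃ u ∈ U, s(s, u) ∈ ω ∧ ω ∈ openConnIn V' u x}))
      * ((prodBernoulli w).real {ω : BondConfig (Fin n) | ∃ u ∈ U, s(s, u) ∈ ω ∧ ω ∈ openConnIn V' u c}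
        + (prodBernoulli w).real (openConnIn V' x c \ {ω : BondConfig (Fin n) | ∃ u ∈ U, s(s, u) ∈ ω ∧ ω ∈ openConnIn V' u x}))
      ≤ (prodBernoulli w).real ({ω : BondConfig (Fin n) | ∃ u ∈ U, s(s, u) ∈ ω ∧ ω ∈ openConnIn V' u b}
            ∩ {ω : BondConfig (Fin n) | ∃ u ∈ U, s(s, u) ∈ ω ∧ ω ∈ openConnIn V' u c})
        + (prodBernoulli w).real
            (((({ω : BondConfig (Fin n) | ∃ u ∈ U, s(s, u) ∈ ω ∧ ω ∈ openConnIn V' u b} ∪ openConnIn V' x b)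
              ∩ ({ω : BondConfig (Fin n) | ∃ u ∈ U, s(s, u) ∈ ω ∧ ω ∈ openConnIn V' u c} ∪ openConnIn V' x c))
              \ ({ω : BondConfig (Fin n) | ∃ u ∈ U, s(s, u) ∈ ω ∧ ω ∈ openConnIn V' u b}
                ∩ {ω : BondConfig (Fin n) | ∃ u ∈ U, s(s, u) ∈ ω ∧ ω ∈ openConnIn V' u c}))) := by
  set Bb : Set (BondConfig (Fin n)) := {ω : BondConfig (Fin n) | ∃ u ∈ U, s(s, u) ∈ ω ∧ ω ∈ openConnIn V' u b}
  set Bc : Set (BondConfig (Fin n)) := {ω : BondConfig (Fin n) | ∃ u ∈ U, s(s, u) ∈ ω ∧ ω ∈ openConnIn V' u c}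
  have hm : ∀ X : Set (BondConfig (Fin n)), MeasurableSet X := fun _ => MeasurableSet.of_discrete
  have hsub : Bb ∩ Bc ⊆ (Bb ∪ openConnIn V' x b) ∩ (Bc ∪ openConnIn V' x c) :=
    fun ω h => ⟨Or.inl h.1, Or.inl h.2⟩
  have hsplit : (prodBernoulli w).real (Bb ∩ Bc)
      + (prodBernoulli w).real (((Bb ∪ openConnIn V' x b) ∩ (Bc ∪ openConnIn V' x c)) \ (Bb ∩ Bc))
      = (prodBernoulli w).real ((Bb ∪ openConnIn V' x b) ∩ (Bc ∪ openConnIn V' x c)) := by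
    have h := measureReal_inter_add_sdiff (μ := prodBernoulli w) (s := (Bb ∪ openConnIn V' x b) ∩ (Bc ∪ openConnIn V' x c))
      (hm (Bb ∩ Bc))
    rwa [Set.inter_eq_self_of_subset_right hsub] at h
  rw [← rootStar_union_split (prodBernoulli w) U V' s x b, ← rootStar_union_split (prodBernoulli w) U V' s x c, hsplit]
  exact prodBernoulli_harris w ((isUpperSet_rootStar U V' s b).union (isUpperSet_openConnIn V' x b))
    ((isUpperSet_rootStar U V' s c).union (isUpperSet_openConnIn V' x c)) (hm _) (hm _)

/-! ### (I1): `E₃` across the separator -/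

set_option maxHeartbeats 400000 in
/-- **(I1) — `E₃` of the increasing star across a two-separation `{s, x}`.**  For `a ∈ insert x L` and `b, c ∈ V₂`,
`E₃({s↔a},{s↔b},{s↔c}) = α·U + α_Λ·BR2 + d_a·TD` with `U = (m_bc − βγ) − λσ + λ²d_bd_c`, `BR2 = 2σ − βd_c − γd_b − 2λd_bd_c`,
`TD = (2ρ_bc − ρm_bc − βρ_c − γρ_b + ρβγ) + λ(ρ(βd_c + γd_b − σ) − d_bρ_c − d_cρ_b) + λ²ρd_bd_c` (near/far numbers as in the module
docstring, supplied through defining hypotheses). [this work] -/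
theorem twoSep_sahiE3_eq (w : Sym2 (Fin n) → unitInterval) (L : Set (Fin n)) {s x a b c : Fin n}
    (hxs : x ≠ s) (hsL : s ∉ L) (hxL : x ∉ L) (haL : a ∈ (insert x L : Set (Fin n)))
    (hbL : b ∉ L) (hbs : b ≠ s) (hcL : c ∉ L) (hcs : c ≠ s)
    (hcross : ∀ y z : Fin n, y ∈ L → z ∉ L → z ≠ s → z ≠ x → w s(y, z) = 0)
    {α αΛ da lam β γ ρ db dc mbc σ ρb ρc ρbc : ℝ}
    (hα : α = (prodBernoulli w).real {ω : BondConfig (Fin n) | ∃ u ∈ L, s(s, u) ∈ ω ∧ ω ∈ openConnIn (insert x L) u a})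
    (hαΛ : αΛ = (prodBernoulli w).real ({ω : BondConfig (Fin n) | ∃ u ∈ L, s(s, u) ∈ ω ∧ ω ∈ openConnIn (insert x L) u a}
      ∩ {ω : BondConfig (Fin n) | ∃ u ∈ L, s(s, u) ∈ ω ∧ ω ∈ openConnIn (insert x L) u x}))
    (hda : da = (prodBernoulli w).real (openConnIn (insert x L) x a
      \ {ω : BondConfig (Fin n) | ∃ u ∈ L, s(s, u) ∈ ω ∧ ω ∈ openConnIn (insert x L) u x}))
    (hlam : lam = (prodBernoulli w).real {ω : BondConfig (Fin n) | ∃ u ∈ L, s(s, u) ∈ ω ∧ ω ∈ openConnIn (insert x L) u x})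
    (hβ : β = (prodBernoulli w).real
      {ω : BondConfig (Fin n) | ∃ u ∈ {y : Fin n | y ∉ L ∧ y ≠ s}, s(s, u) ∈ ω ∧ ω ∈ openConnIn {y | y ∉ L ∧ y ≠ s} u b})
    (hγ : γ = (prodBernoulli w).real
      {ω : BondConfig (Fin n) | ∃ u ∈ {y : Fin n | y ∉ L ∧ y ≠ s}, s(s, u) ∈ ω ∧ ω ∈ openConnIn {y | y ∉ L ∧ y ≠ s} u c})
    (hρ : ρ = (prodBernoulli w).real
      {ω : BondConfig (Fin n) | ∃ u ∈ {y : Fin n | y ∉ L ∧ y ≠ s}, s(s, u) ∈ ω ∧ ω ∈ openConnIn {y | y ∉ L ∧ y ≠ s} u x})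
    (hdb : db = (prodBernoulli w).real (openConnIn {y | y ∉ L ∧ y ≠ s} x b
      \ {ω : BondConfig (Fin n) | ∃ u ∈ {y : Fin n | y ∉ L ∧ y ≠ s}, s(s, u) ∈ ω ∧ ω ∈ openConnIn {y | y ∉ L ∧ y ≠ s} u x}))
    (hdc : dc = (prodBernoulli w).real (openConnIn {y | y ∉ L ∧ y ≠ s} x c
      \ {ω : BondConfig (Fin n) | ∃ u ∈ {y : Fin n | y ∉ L ∧ y ≠ s}, s(s, u) ∈ ω ∧ ω ∈ openConnIn {y | y ∉ L ∧ y ≠ s} u x}))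
    (hmbc : mbc = (prodBernoulli w).real
      ({ω : BondConfig (Fin n) | ∃ u ∈ {y : Fin n | y ∉ L ∧ y ≠ s}, s(s, u) ∈ ω ∧ ω ∈ openConnIn {y | y ∉ L ∧ y ≠ s} u b}
        ∩ {ω : BondConfig (Fin n) | ∃ u ∈ {y : Fin n | y ∉ L ∧ y ≠ s}, s(s, u) ∈ ω ∧ ω ∈ openConnIn {y | y ∉ L ∧ y ≠ s} u c}))
    (hσ : σ = (prodBernoulli w).real
      (((({ω : BondConfig (Fin n) | ∃ u ∈ {y : Fin n | y ∉ L ∧ y ≠ s}, s(s, u) ∈ ω ∧ ω ∈ openConnIn {y | y ∉ L ∧ y ≠ s} u b}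
            ∪ openConnIn {y | y ∉ L ∧ y ≠ s} x b)
          ∩ ({ω : BondConfig (Fin n) | ∃ u ∈ {y : Fin n | y ∉ L ∧ y ≠ s}, s(s, u) ∈ ω ∧ ω ∈ openConnIn {y | y ∉ L ∧ y ≠ s} u c}
            ∪ openConnIn {y | y ∉ L ∧ y ≠ s} x c))
        \ ({ω : BondConfig (Fin n) | ∃ u ∈ {y : Fin n | y ∉ L ∧ y ≠ s}, s(s, u) ∈ ω ∧ ω ∈ openConnIn {y | y ∉ L ∧ y ≠ s} u b}
          ∩ {ω : BondConfig (Fin n) | ∃ u ∈ {y : Fin n | y ∉ L ∧ y ≠ s}, s(s, u) ∈ ω ∧ ω ∈ openConnIn {y | y ∉ L ∧ y ≠ s} u c}))))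
    (hρb : ρb = (prodBernoulli w).real
      ({ω : BondConfig (Fin n) | ∃ u ∈ {y : Fin n | y ∉ L ∧ y ≠ s}, s(s, u) ∈ ω ∧ ω ∈ openConnIn {y | y ∉ L ∧ y ≠ s} u x}
        ∩ {ω : BondConfig (Fin n) | ∃ u ∈ {y : Fin n | y ∉ L ∧ y ≠ s}, s(s, u) ∈ ω ∧ ω ∈ openConnIn {y | y ∉ L ∧ y ≠ s} u b}))
    (hρc : ρc = (prodBernoulli w).real
      ({ω : BondConfig (Fin n) | ∃ u ∈ {y : Fin n | y ∉ L ∧ y ≠ s}, s(s, u) ∈ ω ∧ ω ∈ openConnIn {y | y ∉ L ∧ y ≠ s} u x}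
        ∩ {ω : BondConfig (Fin n) | ∃ u ∈ {y : Fin n | y ∉ L ∧ y ≠ s}, s(s, u) ∈ ω ∧ ω ∈ openConnIn {y | y ∉ L ∧ y ≠ s} u c}))
    (hρbc : ρbc = (prodBernoulli w).real
      ({ω : BondConfig (Fin n) | ∃ u ∈ {y : Fin n | y ∉ L ∧ y ≠ s}, s(s, u) ∈ ω ∧ ω ∈ openConnIn {y | y ∉ L ∧ y ≠ s} u x}
        ∩ ({ω : BondConfig (Fin n) | ∃ u ∈ {y : Fin n | y ∉ L ∧ y ≠ s}, s(s, u) ∈ ω ∧ ω ∈ openConnIn {y | y ∉ L ∧ y ≠ s} u b}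
          ∩ {ω : BondConfig (Fin n) | ∃ u ∈ {y : Fin n | y ∉ L ∧ y ≠ s}, s(s, u) ∈ ω ∧ ω ∈ openConnIn {y | y ∉ L ∧ y ≠ s} u c}))) :
    sahiE3 (prodBernoulli w) (openConn s a) (openConn s b) (openConn s c)
      = α * ((mbc - β * γ) - lam * σ + lam ^ 2 * (db * dc))
        + αΛ * (2 * σ - β * dc - γ * db - 2 * lam * (db * dc))
        + da * ((2 * ρbc - ρ * mbc - β * ρc - γ * ρb + ρ * β * γ)
            + lam * (ρ * (β * dc + γ * db - σ) - db * ρc - dc * ρb) + lam ^ 2 * (ρ * db * dc)) := by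
  subst hα hαΛ hda hlam hβ hγ hρ hdb hdc hmbc hσ hρb hρc hρbc
  -- names
  set V₁ : Set (Fin n) := insert x L with hV₁
  set V₂ : Set (Fin n) := {y | y ∉ L ∧ y ≠ s} with hV₂
  set Aa : Set (BondConfig (Fin n)) := {ω | ∃ u ∈ L, s(s, u) ∈ ω ∧ ω ∈ openConnIn V₁ u a} with hAa
  set SL : Set (BondConfig (Fin n)) := {ω | ∃ u ∈ L, s(s, u) ∈ ω ∧ ω ∈ openConnIn V₁ u x} with hSLd
  set Fa : Set (BondConfig (Fin n)) := openConnIn V₁ x a with hFa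
  set Bb : Set (BondConfig (Fin n)) := {ω | ∃ u ∈ V₂, s(s, u) ∈ ω ∧ ω ∈ openConnIn V₂ u b} with hBb
  set Bc : Set (BondConfig (Fin n)) := {ω | ∃ u ∈ V₂, s(s, u) ∈ ω ∧ ω ∈ openConnIn V₂ u c} with hBc
  set SR : Set (BondConfig (Fin n)) := {ω | ∃ u ∈ V₂, s(s, u) ∈ ω ∧ ω ∈ openConnIn V₂ u x} with hSRd
  set Fb : Set (BondConfig (Fin n)) := openConnIn V₂ x b with hFb
  set Fc : Set (BondConfig (Fin n)) := openConnIn V₂ x c with hFc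
  set E : Set (BondConfig (Fin n)) := ((Bb ∪ Fb) ∩ (Bc ∪ Fc)) \ (Bb ∩ Bc) with hE
  have hm : ∀ X : Set (BondConfig (Fin n)), MeasurableSet X := fun _ => MeasurableSet.of_discrete
  -- (0) the sure set
  set G : Set (BondConfig (Fin n)) := {ω | ∀ e, w e = 0 → e ∉ ω}
  have hG1 : (prodBernoulli w).real G = 1 := real_sureClosed w
  have hGω : ∀ ω ∈ G, ∀ y z : Fin n, y ∈ L → z ∉ L → z ≠ s → z ≠ x → s(y, z) ∉ ω :=
    fun ω hω y z hy hz hzs hzx => hω _ (hcross y z hy hz hzs hzx)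
  -- (1) structural facts
  have fL1 : ∀ ω : BondConfig (Fin n), ω ∈ Aa → ω ∈ Fa → ω ∈ SL :=
    fun ω h hF => rootStar_port_of_rootStar_of_openConnIn L V₁ ω h hF
  have fRb : ∀ ω : BondConfig (Fin n), ω ∈ Bb → ω ∈ Fb → ω ∈ SR :=
    fun ω h hF => rootStar_port_of_rootStar_of_openConnIn V₂ V₂ ω h hF
  have fRc : ∀ ω : BondConfig (Fin n), ω ∈ Bc → ω ∈ Fc → ω ∈ SR :=
    fun ω h hF => rootStar_port_of_rootStar_of_openConnIn V₂ V₂ ω h hF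
  -- (2) determining sets and independence
  set KL : Set (Sym2 (Fin n)) := {z : Sym2 (Fin n) | ¬ z.IsDiag ∧ ∀ v ∈ z, v ∈ V₁} ∪ {z | ∃ u ∈ L, z = s(s, u)}
  set KR : Set (Sym2 (Fin n)) := {z : Sym2 (Fin n) | ¬ z.IsDiag ∧ ∀ v ∈ z, v ∈ V₂} ∪ {z | ∃ u ∈ V₂, z = s(s, u)}
  have indep : ∀ {A B : Set (BondConfig (Fin n))}, DeterminedBy A KL → DeterminedBy B KR →
      (prodBernoulli w).real (A ∩ B) = (prodBernoulli w).real A * (prodBernoulli w).real B :=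
    fun hA hB => twoSep_indep w L hxs hsL hA hB
  have hdiff : ∀ {A B : Set (BondConfig (Fin n))} {K' : Set (Sym2 (Fin n))},
      DeterminedBy A K' → DeterminedBy B K' → DeterminedBy (A \ B) K' := by
    intro A B K' hA hB
    rw [determinedBy_iff] at hA hB ⊢
    intro ω ω' h
    rw [Set.mem_sdiff, Set.mem_sdiff, hA ω ω' h, hB ω ω' h]
  have hunion : ∀ {A B : Set (BondConfig (Fin n))} {K' : Set (Sym2 (Fin n))},
      DeterminedBy A K' → DeterminedBy B K' → DeterminedBy (A ∪ B) K' := by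
    intro A B K' hA hB
    rw [determinedBy_iff] at hA hB ⊢
    intro ω ω' h
    rw [Set.mem_union, Set.mem_union, hA ω ω' h, hB ω ω' h]
  have dAa : DeterminedBy Aa KL := determinedBy_rootStar L V₁ s a
  have dSL : DeterminedBy SL KL := determinedBy_rootStar L V₁ s x
  have dFa : DeterminedBy Fa KL := (IncStarCutVertex.determinedBy_openConnIn_offDiag V₁ x a).mono Set.subset_union_left
  have dBb : DeterminedBy Bb KR := determinedBy_rootStar V₂ V₂ s b
  have dBc : DeterminedBy Bc KR := determinedBy_rootStar V₂ V₂ s c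
  have dSR : DeterminedBy SR KR := determinedBy_rootStar V₂ V₂ s x
  have dFb : DeterminedBy Fb KR := (IncStarCutVertex.determinedBy_openConnIn_offDiag V₂ x b).mono Set.subset_union_left
  have dFc : DeterminedBy Fc KR := (IncStarCutVertex.determinedBy_openConnIn_offDiag V₂ x c).mono Set.subset_union_left
  have dE : DeterminedBy E KR := hdiff ((hunion dBb dFb).inter (hunion dBc dFc)) (dBb.inter dBc)
  -- (3) the root events on the sure set, in disjoint form
  set Sa : Set (BondConfig (Fin n)) := Aa ∪ ((Fa \ SL) ∩ SR) with hSa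
  set Sb : Set (BondConfig (Fin n)) := Bb ∪ ((Fb \ SR) ∩ SL) with hSb
  set Sc : Set (BondConfig (Fin n)) := Bc ∪ ((Fc \ SR) ∩ SL) with hSc
  have cA : ∀ ω ∈ G, (ω ∈ openConn s a ↔ ω ∈ Sa) := by
    intro ω hω
    rw [twoSep_conn_near L hxs hsL hxL (hGω ω hω) haL]
    show ω ∈ Aa ∪ (SR ∩ Fa) ↔ ω ∈ Sa
    rw [rootStar_union_portInter_eq L V₁ s x a SR]
  have cB : ∀ ω ∈ G, (ω ∈ openConn s b ↔ ω ∈ Sb) := by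
    intro ω hω
    rw [twoSep_conn_far L hxs hsL hxL (hGω ω hω) hbL hbs]
    show ω ∈ Bb ∪ (SL ∩ Fb) ↔ ω ∈ Sb
    rw [rootStar_union_portInter_eq V₂ V₂ s x b SL]
  have cC : ∀ ω ∈ G, (ω ∈ openConn s c ↔ ω ∈ Sc) := by
    intro ω hω
    rw [twoSep_conn_far L hxs hsL hxL (hGω ω hω) hcL hcs]
    show ω ∈ Bc ∪ (SL ∩ Fc) ↔ ω ∈ Sc
    rw [rootStar_union_portInter_eq V₂ V₂ s x c SL]
  rw [sahiE3_congr_of_sure (hm G) hG1 cA cB cC, sahiE3_def]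
  -- (4) the seven moments
  have ma : (prodBernoulli w).real Sa = (prodBernoulli w).real Aa + (prodBernoulli w).real (Fa \ SL) * (prodBernoulli w).real SR := by
    rw [← indep (hdiff dFa dSL) dSR]
    exact measureReal_union (rootStar_disjoint_portDiff_inter L V₁ s x a SR) (hm _) (measure_ne_top _ _) (measure_ne_top _ _)
  have mfar : ∀ {t : Fin n} (Bt Ft : Set (BondConfig (Fin n))), Bt = {ω | ∃ u ∈ V₂, s(s, u) ∈ ω ∧ ω ∈ openConnIn V₂ u t} →
      Ft = openConnIn V₂ x t → DeterminedBy Ft KR →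
      (prodBernoulli w).real (Bt ∪ ((Ft \ SR) ∩ SL))
        = (prodBernoulli w).real Bt + (prodBernoulli w).real SL * (prodBernoulli w).real (Ft \ SR) := by
    rintro t Bt Ft rfl rfl dF
    rw [← indep dSL (hdiff dF dSR), Set.inter_comm SL (openConnIn V₂ x t \ SR)]
    exact measureReal_union (rootStar_disjoint_portDiff_inter V₂ V₂ s x t SL) (hm _) (measure_ne_top _ _) (measure_ne_top _ _)
  have mb : (prodBernoulli w).real Sb = (prodBernoulli w).real Bb + (prodBernoulli w).real SL * (prodBernoulli w).real (Fb \ SR) :=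
    mfar Bb Fb rfl rfl dFb
  have mc : (prodBernoulli w).real Sc = (prodBernoulli w).real Bc + (prodBernoulli w).real SL * (prodBernoulli w).real (Fc \ SR) :=
    mfar Bc Fc rfl rfl dFc
  have hsetBC : Sb ∩ Sc = (Bb ∩ Bc) ∪ (E ∩ SL) := rootStar_pair_inter_eq V₂ V₂ s x b c SL
  have mbc' : (prodBernoulli w).real (Sb ∩ Sc)
      = (prodBernoulli w).real (Bb ∩ Bc) + (prodBernoulli w).real SL * (prodBernoulli w).real E := by
    rw [hsetBC, ← indep dSL dE, Set.inter_comm SL E]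
    exact measureReal_union (Set.disjoint_left.2 fun ω h1 h2 => h2.1.2 h1) (hm _) (measure_ne_top _ _) (measure_ne_top _ _)
  have mnear : ∀ {t : Fin n} (Bt Ft : Set (BondConfig (Fin n))), Bt = {ω | ∃ u ∈ V₂, s(s, u) ∈ ω ∧ ω ∈ openConnIn V₂ u t} →
      Ft = openConnIn V₂ x t → DeterminedBy Bt KR → DeterminedBy Ft KR →
      (prodBernoulli w).real (Sa ∩ (Bt ∪ ((Ft \ SR) ∩ SL)))
        = (prodBernoulli w).real Aa * (prodBernoulli w).real Bt
          + (prodBernoulli w).real (Aa ∩ SL) * (prodBernoulli w).real (Ft \ SR)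
          + (prodBernoulli w).real (Fa \ SL) * (prodBernoulli w).real (SR ∩ Bt) := by
    rintro t Bt Ft rfl rfl dB dF
    have fRt : ∀ ω : BondConfig (Fin n), ω ∈ {ω | ∃ u ∈ V₂, s(s, u) ∈ ω ∧ ω ∈ openConnIn V₂ u t} → ω ∈ openConnIn V₂ x t → ω ∈ SR :=
      fun ω h hF => rootStar_port_of_rootStar_of_openConnIn V₂ V₂ ω h hF
    have hset : Sa ∩ ({ω | ∃ u ∈ V₂, s(s, u) ∈ ω ∧ ω ∈ openConnIn V₂ u t} ∪ ((openConnIn V₂ x t \ SR) ∩ SL))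
        = ((Aa ∩ {ω | ∃ u ∈ V₂, s(s, u) ∈ ω ∧ ω ∈ openConnIn V₂ u t}) ∪ ((Aa ∩ SL) ∩ (openConnIn V₂ x t \ SR)))
          ∪ ((Fa \ SL) ∩ (SR ∩ {ω | ∃ u ∈ V₂, s(s, u) ∈ ω ∧ ω ∈ openConnIn V₂ u t})) := by
      rw [hSa]
      ext ω
      simp only [Set.mem_union, Set.mem_inter_iff, Set.mem_sdiff]
      tauto
    rw [hset, measureReal_union ?_ (hm _) (measure_ne_top _ _) (measure_ne_top _ _), measureReal_union ?_ (hm _) (measure_ne_top _ _) (measure_ne_top _ _), indep dAa dB, indep (dAa.inter dSL) (hdiff dF dSR),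
      indep (hdiff dFa dSL) (dSR.inter dB)]
    · exact Set.disjoint_left.2 fun ω h1 h2 => h2.2.2 (fRt ω h1.2 h2.2.1)
    · exact Set.disjoint_left.2 fun ω h1 h2 => by
        rcases h1 with h1 | h1
        · exact h2.1.2 (fL1 ω h1.1 h2.1.1)
        · exact h2.1.2 h1.1.2
  have mab : (prodBernoulli w).real (Sa ∩ Sb)
      = (prodBernoulli w).real Aa * (prodBernoulli w).real Bb
        + (prodBernoulli w).real (Aa ∩ SL) * (prodBernoulli w).real (Fb \ SR)
        + (prodBernoulli w).real (Fa \ SL) * (prodBernoulli w).real (SR ∩ Bb) := mnear Bb Fb rfl rfl dBb dFb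
  have mac : (prodBernoulli w).real (Sa ∩ Sc)
      = (prodBernoulli w).real Aa * (prodBernoulli w).real Bc
        + (prodBernoulli w).real (Aa ∩ SL) * (prodBernoulli w).real (Fc \ SR)
        + (prodBernoulli w).real (Fa \ SL) * (prodBernoulli w).real (SR ∩ Bc) := mnear Bc Fc rfl rfl dBc dFc
  have mabc : (prodBernoulli w).real (Sa ∩ Sb ∩ Sc)
      = (prodBernoulli w).real Aa * (prodBernoulli w).real (Bb ∩ Bc)
        + (prodBernoulli w).real (Aa ∩ SL) * (prodBernoulli w).real E
        + (prodBernoulli w).real (Fa \ SL) * (prodBernoulli w).real (SR ∩ (Bb ∩ Bc)) := by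
    have hset : Sa ∩ Sb ∩ Sc = ((Aa ∩ (Bb ∩ Bc)) ∪ ((Aa ∩ SL) ∩ E)) ∪ ((Fa \ SL) ∩ (SR ∩ (Bb ∩ Bc))) := by
      rw [Set.inter_assoc, hsetBC, hSa]
      ext ω
      simp only [Set.mem_union, Set.mem_inter_iff, Set.mem_sdiff]
      tauto
    rw [hset, measureReal_union ?_ (hm _) (measure_ne_top _ _) (measure_ne_top _ _), measureReal_union ?_ (hm _) (measure_ne_top _ _) (measure_ne_top _ _), indep dAa (dBb.inter dBc), indep (dAa.inter dSL) dE,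
      indep (hdiff dFa dSL) (dSR.inter (dBb.inter dBc))]
    · exact Set.disjoint_left.2 fun ω h1 h2 => h2.2.2 h1.2
    · exact Set.disjoint_left.2 fun ω h1 h2 => by
        rcases h1 with h1 | h1
        · exact h2.1.2 (fL1 ω h1.1 h2.1.1)
        · exact h2.1.2 h1.1.2
  -- (5) assemble
  rw [mabc, mab, mac, mbc', ma, mb, mc]
  ring

end IncStar

end Summit.CriticalPhenomena.PercolationContinuityZ3.Theorems
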